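import Summits.ABC.ABC.Theorems.TwoSixPencilPencilBound
import Summits.ABC.ABC.Theorems.TwoSixPencilTwoSixDictionary
import Summits.ABC.ABC.Theorems.TwoSixPencilTwoSixPayoff
import HarnessLib

/-!
# Target `TwoSixClassEpsShape` (stmt-ABC-24781, route `TwoSixPencil`) — THE ℤ/2×ℤ/6 CLASS THEOREM, proved

`Summits/ABC/ABC/Theorems/TwoSixPencilTwoSixClassEpsShape.lean`: **Szpiro's conjecture in ε-shape
with exponent `1/6` for every elliptic curve over `ℚ` whose torsion subgroup contains ℤ/2×ℤ/6**, on
Kubert's integral model: for every `ε > 0` there is `C` with `log |Δ_min(W)| ≤ C · N_W^{1/6+ε}`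
for all coprime `u, w` with `F(u,w) = w(u−w)(u−3w)(u+3w)(u−5w)(u−9w) ≠ 0` and every elliptic
`W = ⟨u²+2uw−19w², 2w(u−5w)(u−w)², 2w(u−5w)(u−w)²(u−3w)(u+3w), 0, 0⟩ / ℚ`.

Assembly of the three proved items of the route (this seat; KEY PENCIL-ENGINE batch 58 + desk
«GO TwoSix» 2026-08-28T03:30:57Z): the general pencil theorem `pencilBound_proof`
(stmt-ABC-24782, Stewart–Yu 2001 Thm 2 on a sub-pencil), the dictionary `twoSixDictionary_proof`
(stmt-ABC-24784, Tate's algorithm away from `6`), and the payoff `twoSixPayoff_proof`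
(stmt-ABC-24785, `k = 6`).

HONESTY. An ε-COLUMN / SZPIRO-BY-CLASS RECORD (worst-case exponent `1/6` on the ℤ/2×ℤ/6 class):
NOT abc, NOT A-PS (polynomial Szpiro for ALL `E/ℚ`), NOT rung A1′; the route reaches `ABC` only
through its DECLARED RESIDUAL `TwoSixResidual` (stmt-ABC-24783, never staffed); abc distance = that
residual; a class record is not a rung. [cite: StewartYu2001, Theorem 2] [cite: Kubert1976, Table 3]
-/

set_option linter.dupNamespace false

namespace Summit.ABC.ABC.Theorems

/-- **Target `TwoSixClassEpsShape` (stmt-ABC-24781) — proved**: for every `ε > 0` there is `C` such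
that every elliptic curve `E/ℚ` with torsion ⊇ ℤ/2×ℤ/6, in Kubert's form (`gcd(u,w) = 1`,
`F(u,w) ≠ 0`), satisfies `log|Δ_min| ≤ C · N^{1/6+ε}`. Proof: `twoSixPayoff_proof pencilBound_proof
twoSixDictionary_proof`. ε-shape `1/6` on the ℤ/2×ℤ/6 class — NOT abc, NOT A-PS, NOT A1′.
[cite: StewartYu2001, Theorem 2] -/
theorem twoSixClassEpsShape_proof :
    Summit.ABC.ABC.Theses.TwoSixPencil.TwoSixClassEpsShape := by
  have h := twoSixPayoff_proof
  unfold Summit.ABC.ABC.Theses.TwoSixPencil.TwoSixPayoff at h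
  exact h pencilBound_proof twoSixDictionary_proof

end Summit.ABC.ABC.Theorems
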